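import Mathlib
import Literature.Analysis.Complex.RiemannMapping

/-!
# Schwarz–Pick coefficient bound and rotation averaging (venture `DiscreteObjects`, target L)

Cell `pub-namedobj`, seat `pub-namedobj-mahler` (gen 7). Framing: lottery ticket; floor = certified
bounds/negative ranges.

Analytic lemmas for the nonreciprocal Mahler-measure bound (`NonreciprocalMeasureBound.lean`):

* the two Blaschke-factor bounds `‖w - a‖ ≤ ‖1 - ā w‖` (`‖a‖ ≤ 1`) and `‖1 - ā w‖ ≤ ‖w - a‖`
  (`‖a‖ ≥ 1`) for `‖w‖ ≤ 1`, from the Möbius identity of `Literature.Analysis.Complex.RiemannMapping`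
  (`Complex.norm_sq_one_sub_conj_mul_sub`);
* `norm_le_one_of_eq_pow_mul` — if `Θ` maps the unit disc into the closed unit disc and
  `Θ z = z ^ k * Ψ z` with `Ψ` holomorphic (`k ≥ 1`), then `‖Ψ 0‖ ≤ 1` (Mathlib's higher-order
  Schwarz lemma `Complex.dist_le_mul_div_pow_of_mapsTo_ball_of_isLittleO`);
* `norm_coeff_le_one_sub_norm_sq` — the Schwarz–Pick bound on a `k`-th coefficient: if `Φ` maps the
  unit disc into the closed unit disc and `Φ z = c + z ^ k * ψ z` (`k ≥ 1`, `ψ` holomorphic), then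
  `‖ψ 0‖ ≤ 1 - ‖c‖²` ([McKee–Smyth, *Around the Unit Circle*, Prop. 12.11(b)]);
* `exists_flat_of_rotation_invariant` — a holomorphic `Φ` on the disc with `Φ (ω z) = Φ z` for a
  primitive `k`-th root of unity `ω` is `Φ 0 + z ^ k * ψ z` with `ψ` holomorphic (removable
  singularities, `Complex.differentiableOn_dslope`).
-/

namespace Summit.Ventures.DiscreteObjects.Mahler

open Complex Metric Set Filter Topology
open scoped ComplexConjugate

/-! ### Möbius / Blaschke factor inequalities -/

/-- Blaschke factor bound (zero inside): for `‖a‖ ≤ 1` and `‖w‖ ≤ 1`, `‖w - a‖ ≤ ‖1 - conj a * w‖`. -/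
theorem norm_sub_le_norm_one_sub_conj_mul {a w : ℂ} (ha : ‖a‖ ≤ 1) (hw : ‖w‖ ≤ 1) :
    ‖w - a‖ ≤ ‖1 - conj a * w‖ := by
  have h := Complex.norm_sq_one_sub_conj_mul_sub a w
  have h1 : 0 ≤ (1 - ‖a‖ ^ 2) * (1 - ‖w‖ ^ 2) := by
    apply mul_nonneg <;> nlinarith [norm_nonneg a, norm_nonneg w]
  have h2 : ‖w - a‖ ^ 2 ≤ ‖1 - conj a * w‖ ^ 2 := by linarith
  exact (pow_le_pow_iff_left₀ (norm_nonneg _) (norm_nonneg _) two_ne_zero).mp h2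

/-- Blaschke factor bound (zero outside): for `1 ≤ ‖a‖` and `‖w‖ ≤ 1`, `‖1 - conj a * w‖ ≤ ‖w - a‖`. -/
theorem norm_one_sub_conj_mul_le_norm_sub {a w : ℂ} (ha : 1 ≤ ‖a‖) (hw : ‖w‖ ≤ 1) :
    ‖1 - conj a * w‖ ≤ ‖w - a‖ := by
  have h := Complex.norm_sq_one_sub_conj_mul_sub a w
  have h1 : (1 - ‖a‖ ^ 2) * (1 - ‖w‖ ^ 2) ≤ 0 := by
    apply mul_nonpos_of_nonpos_of_nonneg <;> nlinarith [norm_nonneg a, norm_nonneg w]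
  have h2 : ‖1 - conj a * w‖ ^ 2 ≤ ‖w - a‖ ^ 2 := by linarith
  exact (pow_le_pow_iff_left₀ (norm_nonneg _) (norm_nonneg _) two_ne_zero).mp h2

/-- The Möbius map `w ↦ (w - a)/(1 - conj a * w)` (`‖a‖ < 1`) sends the closed unit disc into itself. -/
theorem norm_moebius_le_one {a w : ℂ} (ha : ‖a‖ < 1) (hw : ‖w‖ ≤ 1) :
    ‖(w - a) / (1 - conj a * w)‖ ≤ 1 := by
  rw [norm_div]
  exact div_le_one_of_le₀ (norm_sub_le_norm_one_sub_conj_mul ha.le hw) (norm_nonneg _)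

/-! ### Schwarz-type bounds -/

/-- **Order-`k` Schwarz lemma at the origin.** If `Θ` maps the open unit disc into the closed unit
disc and `Θ z = z ^ k * Ψ z` there, with `Ψ` holomorphic on the disc and `k ≥ 1`, then `‖Ψ 0‖ ≤ 1`. -/
theorem norm_le_one_of_eq_pow_mul {Θ Ψ : ℂ → ℂ} {k : ℕ} (hk : 1 ≤ k)
    (hΨ : DifferentiableOn ℂ Ψ (ball 0 1)) (hbd : ∀ z ∈ ball (0 : ℂ) 1, ‖Θ z‖ ≤ 1)
    (hrep : ∀ z ∈ ball (0 : ℂ) 1, Θ z = z ^ k * Ψ z) : ‖Ψ 0‖ ≤ 1 := by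
  have hball : ball (0 : ℂ) 1 ∈ 𝓝 (0 : ℂ) := ball_mem_nhds _ one_pos
  have hΘd : DifferentiableOn ℂ Θ (ball 0 1) := by
    have h1 : DifferentiableOn ℂ (fun z : ℂ => z ^ k * Ψ z) (ball 0 1) :=
      (differentiableOn_id.pow k).mul hΨ
    exact h1.congr hrep
  have hΘ0 : Θ 0 = 0 := by
    rw [hrep 0 (mem_ball_self one_pos)]; simp [zero_pow (by omega : k ≠ 0)]
  have hmaps : MapsTo Θ (ball (0 : ℂ) 1) (closedBall (Θ 0) 1) := by
    intro z hz
    rw [hΘ0, mem_closedBall, dist_zero_right]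
    exact hbd z hz
  -- `Θ z - Θ 0 = o(‖z‖ ^ (k-1))` at `0`
  have hcontΨ : ContinuousAt Ψ 0 := (hΨ.differentiableAt hball).continuousAt
  have hlit : (fun z => Θ z - Θ 0) =o[𝓝 (0 : ℂ)] fun w => ‖w - 0‖ ^ (k - 1) := by
    have hev : (fun z => Θ z - Θ 0) =ᶠ[𝓝 (0 : ℂ)] fun z => z ^ (k - 1) * (z * Ψ z) := by
      filter_upwards [hball] with z hz
      rw [hΘ0, sub_zero, hrep z hz, ← mul_assoc, ← pow_succ, Nat.sub_add_cancel hk]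
    refine Asymptotics.IsLittleO.congr' ?_ hev.symm EventuallyEq.rfl
    have h1 : (fun z : ℂ => z ^ (k - 1)) =O[𝓝 (0 : ℂ)] fun w => ‖w - 0‖ ^ (k - 1) := by
      apply Asymptotics.IsBigO.of_bound 1
      filter_upwards with z
      simp
    have h2 : (fun z : ℂ => z * Ψ z) =o[𝓝 (0 : ℂ)] fun _ => (1 : ℝ) := by
      rw [Asymptotics.isLittleO_one_iff]
      have : Tendsto (fun z : ℂ => z * Ψ z) (𝓝 0) (𝓝 (0 * Ψ 0)) :=
        (continuous_id.tendsto 0).mul hcontΨ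
      simpa using this
    simpa using h1.mul_isLittleO h2
  -- the higher-order Schwarz lemma
  have hS : ∀ z ∈ ball (0 : ℂ) 1, ‖z‖ ^ k * ‖Ψ z‖ ≤ ‖z‖ ^ k := by
    intro z hz
    have h := Complex.dist_le_mul_div_pow_of_mapsTo_ball_of_isLittleO hΘd hmaps hlit hz
    rw [Nat.sub_add_cancel hk, hΘ0, dist_zero_right, dist_zero_right, div_one, one_mul,
      hrep z hz, norm_mul, norm_pow] at h
    exact h
  -- hence `‖Ψ z‖ ≤ 1` on the punctured disc, and at `0` by continuity
  have hpunct : ∀ᶠ z in 𝓝[≠] (0 : ℂ), Ψ z ∈ closedBall (0 : ℂ) 1 := by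
    have hmem : {(0 : ℂ)}ᶜ ∩ ball (0 : ℂ) 1 ∈ 𝓝[≠] (0 : ℂ) := inter_mem_nhdsWithin _ hball
    filter_upwards [hmem] with z hz
    obtain ⟨hz0, hz1⟩ := hz
    have hz0' : z ≠ 0 := hz0
    have hpos : 0 < ‖z‖ ^ k := pow_pos (norm_pos_iff.mpr hz0') k
    rw [mem_closedBall, dist_zero_right]
    have := hS z hz1
    by_contra hgt
    push Not at hgt
    have : ‖z‖ ^ k * 1 < ‖z‖ ^ k * ‖Ψ z‖ := mul_lt_mul_of_pos_left hgt hpos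
    linarith
  have htend : Tendsto Ψ (𝓝[≠] (0 : ℂ)) (𝓝 (Ψ 0)) :=
    hcontΨ.tendsto.mono_left nhdsWithin_le_nhds
  have hmem0 : Ψ 0 ∈ closedBall (0 : ℂ) 1 := isClosed_closedBall.mem_of_tendsto htend hpunct
  simpa using hmem0


/-- **Schwarz–Pick bound on a `k`-th Taylor coefficient** ([McKee–Smyth, *Around the Unit Circle*,
Prop. 12.11(b)]).  If `Φ` maps the open unit disc into the closed unit disc and
`Φ z = c + z ^ k * ψ z` there (`k ≥ 1`, `ψ` holomorphic on the disc), then `‖ψ 0‖ ≤ 1 - ‖c‖ ^ 2`.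
Proof: for `0 < t < 1` compose `t • Φ` with the disc automorphism moving `t c` to `0` and apply the
order-`k` Schwarz lemma; then let `t → 1`. -/
theorem norm_coeff_le_one_sub_norm_sq {Φ ψ : ℂ → ℂ} {c : ℂ} {k : ℕ} (hk : 1 ≤ k)
    (hψ : DifferentiableOn ℂ ψ (ball 0 1)) (hbd : ∀ z ∈ ball (0 : ℂ) 1, ‖Φ z‖ ≤ 1)
    (hrep : ∀ z ∈ ball (0 : ℂ) 1, Φ z = c + z ^ k * ψ z) : ‖ψ 0‖ ≤ 1 - ‖c‖ ^ 2 := by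
  have hball : ball (0 : ℂ) 1 ∈ 𝓝 (0 : ℂ) := ball_mem_nhds _ one_pos
  have hΦd : DifferentiableOn ℂ Φ (ball 0 1) := by
    have h1 : DifferentiableOn ℂ (fun z : ℂ => c + z ^ k * ψ z) (ball 0 1) :=
      ((differentiableOn_id.pow k).mul hψ).const_add c
    exact h1.congr hrep
  have hc : ‖c‖ ≤ 1 := by
    have h := hbd 0 (mem_ball_self one_pos)
    rw [hrep 0 (mem_ball_self one_pos)] at h
    simpa [zero_pow (by omega : k ≠ 0)] using h
  -- the bound `t ‖ψ 0‖ ≤ 1 - t² ‖c‖²` for every `t ∈ (0,1)`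
  have key : ∀ t : ℝ, 0 < t → t < 1 → t * ‖ψ 0‖ ≤ 1 - t ^ 2 * ‖c‖ ^ 2 := by
    intro t ht0 ht1
    set ct : ℂ := (t : ℂ) * c with hct
    have hct_norm : ‖ct‖ = t * ‖c‖ := by
      rw [hct, norm_mul, Complex.norm_real, Real.norm_of_nonneg ht0.le]
    have hct1 : ‖ct‖ < 1 := by
      rw [hct_norm]; nlinarith [norm_nonneg c]
    -- `t Φ` maps the disc into the closed disc of radius `t`
    have htΦ : ∀ z ∈ ball (0 : ℂ) 1, ‖(t : ℂ) * Φ z‖ ≤ 1 := by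
      intro z hz
      rw [norm_mul, Complex.norm_real, Real.norm_of_nonneg ht0.le]
      nlinarith [hbd z hz, norm_nonneg (Φ z)]
    have hden : ∀ z ∈ ball (0 : ℂ) 1, 1 - conj ct * ((t : ℂ) * Φ z) ≠ 0 := fun z hz =>
      Complex.one_sub_conj_mul_ne_zero hct1 (htΦ z hz)
    -- the composed map `Θ = μ ∘ (t Φ)` and its quotient `Ψ = Θ / z^k`
    set Θ : ℂ → ℂ := fun z => ((t : ℂ) * Φ z - ct) / (1 - conj ct * ((t : ℂ) * Φ z)) with hΘ
    set Ψ : ℂ → ℂ := fun z => (t : ℂ) * ψ z / (1 - conj ct * ((t : ℂ) * Φ z)) with hΨ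
    have hΨd : DifferentiableOn ℂ Ψ (ball 0 1) := by
      apply DifferentiableOn.div
      · exact (differentiableOn_const _).mul hψ
      · exact (differentiableOn_const _).sub
          ((differentiableOn_const _).mul ((differentiableOn_const _).mul hΦd))
      · exact hden
    have hΘbd : ∀ z ∈ ball (0 : ℂ) 1, ‖Θ z‖ ≤ 1 := fun z hz =>
      norm_moebius_le_one hct1 (htΦ z hz)
    have hΘrep : ∀ z ∈ ball (0 : ℂ) 1, Θ z = z ^ k * Ψ z := by
      intro z hz
      simp only [hΘ, hΨ]
      rw [mul_div_assoc']
      congr 1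
      rw [hrep z hz, hct]
      ring
    have h1 : ‖Ψ 0‖ ≤ 1 := norm_le_one_of_eq_pow_mul hk hΨd hΘbd hΘrep
    -- evaluate `Ψ 0 = t ψ 0 / (1 - t² ‖c‖²)`
    have hΦ0 : Φ 0 = c := by
      rw [hrep 0 (mem_ball_self one_pos)]; simp [zero_pow (by omega : k ≠ 0)]
    have hden0 : (1 - conj ct * ((t : ℂ) * Φ 0)) = ((1 - t ^ 2 * ‖c‖ ^ 2 : ℝ) : ℂ) := by
      rw [hΦ0, hct, map_mul, Complex.conj_ofReal]
      have : conj c * c = ((‖c‖ : ℂ)) ^ 2 := Complex.conj_mul' c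
      push_cast
      linear_combination (-(t : ℂ) ^ 2) * this
    have hpos : 0 < 1 - t ^ 2 * ‖c‖ ^ 2 := by
      have : t ^ 2 * ‖c‖ ^ 2 < 1 := by
        calc t ^ 2 * ‖c‖ ^ 2 ≤ t ^ 2 * 1 := by
              apply mul_le_mul_of_nonneg_left _ (sq_nonneg t); nlinarith [norm_nonneg c]
          _ < 1 := by nlinarith
      linarith
    have hΨ0 : ‖Ψ 0‖ = t * ‖ψ 0‖ / (1 - t ^ 2 * ‖c‖ ^ 2) := by
      simp only [hΨ]
      rw [hden0, norm_div, norm_mul, Complex.norm_real, Complex.norm_real,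
        Real.norm_of_nonneg ht0.le, Real.norm_of_nonneg hpos.le]
    rw [hΨ0, div_le_one hpos] at h1
    exact h1
  -- let `t → 1`
  have hcont : ContinuousWithinAt (fun t : ℝ => t * ‖ψ 0‖ + t ^ 2 * ‖c‖ ^ 2) (Set.Iio 1) 1 := by
    apply Continuous.continuousWithinAt; fun_prop
  have hle : ∀ᶠ t in 𝓝[<] (1 : ℝ), t * ‖ψ 0‖ + t ^ 2 * ‖c‖ ^ 2 ≤ 1 := by
    have hmem : Set.Ioo (0 : ℝ) 1 ∈ 𝓝[<] (1 : ℝ) := Ioo_mem_nhdsLT one_pos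
    filter_upwards [hmem] with t ht
    have := key t ht.1 ht.2
    linarith
  have hlim : Tendsto (fun t : ℝ => t * ‖ψ 0‖ + t ^ 2 * ‖c‖ ^ 2) (𝓝[<] (1 : ℝ))
      (𝓝 (1 * ‖ψ 0‖ + 1 ^ 2 * ‖c‖ ^ 2)) := hcont.tendsto
  have := le_of_tendsto hlim hle
  linarith

/-! ### Rotation averaging -/

/-- A function on the punctured disc that is continuous at `0` and vanishes off `0` vanishes at `0`. -/
theorem eq_zero_of_eq_zero_off_zero {G : ℂ → ℂ} (hG : ContinuousAt G 0)
    (h : ∀ z ∈ ball (0 : ℂ) 1, z ≠ 0 → G z = 0) : G 0 = 0 := by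
  have hball : ball (0 : ℂ) 1 ∈ 𝓝 (0 : ℂ) := ball_mem_nhds _ one_pos
  have hmem : {(0 : ℂ)}ᶜ ∩ ball (0 : ℂ) 1 ∈ 𝓝[≠] (0 : ℂ) := inter_mem_nhdsWithin _ hball
  have hev : G =ᶠ[𝓝[≠] (0 : ℂ)] fun _ => 0 := by
    filter_upwards [hmem] with z hz
    exact h z hz.2 hz.1
  have h1 : Tendsto G (𝓝[≠] (0 : ℂ)) (𝓝 (G 0)) := hG.tendsto.mono_left nhdsWithin_le_nhds
  have h2 : Tendsto G (𝓝[≠] (0 : ℂ)) (𝓝 0) := (tendsto_const_nhds).congr' hev.symm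
  exact tendsto_nhds_unique h1 h2

/-- **Rotation-invariant holomorphic functions are flat to order `k`.**  If `Φ` is holomorphic on the
unit disc and `Φ (ω z) = Φ z` for a primitive `k`-th root of unity `ω` (`k ≥ 1`), then
`Φ z = Φ 0 + z ^ k * ψ z` with `ψ` holomorphic on the disc (its Taylor coefficients of index
`1, …, k-1` vanish).  Proof by `k` removable singularities (`dslope`). -/
theorem exists_flat_of_rotation_invariant {Φ : ℂ → ℂ} {ω : ℂ} {k : ℕ} (hω : IsPrimitiveRoot ω k)
    (hk : 1 ≤ k) (hΦ : DifferentiableOn ℂ Φ (ball 0 1))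
    (hinv : ∀ z ∈ ball (0 : ℂ) 1, Φ (ω * z) = Φ z) :
    ∃ ψ : ℂ → ℂ, DifferentiableOn ℂ ψ (ball 0 1) ∧ ∀ z ∈ ball (0 : ℂ) 1, Φ z = Φ 0 + z ^ k * ψ z := by
  have hball : ball (0 : ℂ) 1 ∈ 𝓝 (0 : ℂ) := ball_mem_nhds _ one_pos
  have hω1 : ‖ω‖ = 1 := hω.norm'_eq_one (by omega)
  have hωball : ∀ z ∈ ball (0 : ℂ) 1, ω * z ∈ ball (0 : ℂ) 1 := by
    intro z hz
    rw [mem_ball_zero_iff] at hz ⊢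
    rw [norm_mul, hω1, one_mul]; exact hz
  -- induction on the order of flatness `j ≤ k`
  suffices H : ∀ j : ℕ, j ≤ k → ∃ ψ : ℂ → ℂ, DifferentiableOn ℂ ψ (ball 0 1) ∧
      ∀ z ∈ ball (0 : ℂ) 1, Φ z = Φ 0 + z ^ j * ψ z from H k le_rfl
  intro j
  induction j with
  | zero =>
    intro _
    exact ⟨fun z => Φ z - Φ 0, hΦ.sub_const _, fun z _ => by ring⟩
  | succ j ih =>
    intro hjk
    obtain ⟨ψ, hψd, hψ⟩ := ih (by omega)
    -- the current coefficient `ψ 0` vanishes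
    have hψ0 : ψ 0 = 0 := by
      rcases Nat.eq_zero_or_pos j with hj0 | hjpos
      · subst hj0
        have := hψ 0 (mem_ball_self one_pos)
        simpa using this
      · -- rotation invariance: `ω^j ψ (ω z) = ψ z` off `0`, hence at `0`
        have hωj : ω ^ j ≠ 1 := hω.pow_ne_one_of_pos_of_lt hjpos.ne' (by omega)
        set G : ℂ → ℂ := fun z => ω ^ j * ψ (ω * z) - ψ z with hG
        have hGc : ContinuousAt G 0 := by
          have hψc : ContinuousAt ψ 0 := (hψd.differentiableAt hball).continuousAt
          have hψc' : ContinuousAt (fun z => ψ (ω * z)) 0 := by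
            have h1 : ContinuousAt ψ (ω * 0) := by rw [mul_zero]; exact hψc
            exact ContinuousAt.comp (f := fun z : ℂ => ω * z) h1 (by fun_prop)
          exact (hψc'.const_mul _).sub hψc
        have hGoff : ∀ z ∈ ball (0 : ℂ) 1, z ≠ 0 → G z = 0 := by
          intro z hz hz0
          have h1 := hψ z hz
          have h2 := hψ (ω * z) (hωball z hz)
          rw [hinv z hz, h1, mul_pow] at h2
          -- `z^j * ψ z = ω^j * z^j * ψ (ω z)`
          have h3 : z ^ j * (ω ^ j * ψ (ω * z) - ψ z) = 0 := by linear_combination -h2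
          have hzj : z ^ j ≠ 0 := pow_ne_zero j hz0
          simpa [hG] using (mul_eq_zero.mp h3).resolve_left hzj
        have hG0 := eq_zero_of_eq_zero_off_zero hGc hGoff
        simp only [hG, mul_zero] at hG0
        have : (ω ^ j - 1) * ψ 0 = 0 := by linear_combination hG0
        exact (mul_eq_zero.mp this).resolve_left (sub_ne_zero.mpr hωj)
    -- peel off one more factor of `z`
    refine ⟨dslope ψ 0, (Complex.differentiableOn_dslope hball).mpr hψd, fun z hz => ?_⟩
    have hds : (z - 0) • dslope ψ 0 z = ψ z - ψ 0 := sub_smul_dslope ψ 0 z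
    rw [sub_zero, hψ0, sub_zero, smul_eq_mul] at hds
    rw [hψ z hz, ← hds]
    ring

end Summit.Ventures.DiscreteObjects.Mahler
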